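import Summits.Ventures.CertifiedArithmetic.LowPrec.GemmFirstRegimeWindowRows
import Summits.Ventures.CertifiedArithmetic.LowPrec.GemmFirstRegimeBinary16
import HarnessLib

/-!
# GEMM worst case LXIX-f — THE WINDOW past the first regime, part 6: E2M1·E2M1 products
# accumulated in binary16, `1040 ≤ n ≤ 1043`

HONEST FRAMING: certified error envelopes and provably optimal rounding/accumulation schemes for
low-precision formats under stated cost models; every table by two implementations; no hardware or
vendor claims.

File LXV (`GemmFirstRegimeBinary16`) decided `W_11(n)` for `n ≤ 1039` (`(n-15)/(2033+n)` from
`n = 16` on) by transferring the all-precision first-regime law to IEEE binary16 through a widened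
format; file LXVIII showed that value FAILS for every `n ≥ 1044`.  The four lengths
`1040 ≤ n ≤ 1043` were decided by neither.  This file closes them:
`W_11(n) = (n-15)/(2033+n)` for EVERY `16 ≤ n ≤ 1043` (`worstP_Binary16_law_window`), i.e.
`W_11(1040) = 1025/3073`, `W_11(1041) = 513/1537`, `W_11(1042) = 1027/3075`,
`W_11(1043) = 257/769` (`worstP_Binary16_window_values`) — so the binary16 row is now decided
by a theorem for every `n ≤ 1043`, and the first-regime value fails exactly from `n = 1044` on.
* the window law of files LXIX-d/e in the widened format (`worstP_window`, `k ≤ 2^10 + 4`);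
* the range transfer of file LXV one window further: the a-priori bound
  `|ŝ_j| ≤ (3/2)·Σ_{i≤j}|x_i|` now from the window bound `R ≤ k/(T+k) ≤ ½` up to
  `j ≤ j₀ + 2^10 + 4` (`abs_seqSum_le_window`), so every argument of a word of `≤ 1043` letters
  stays below `54·1042 + 36 < 65504` (`E2M1_args_lt_Binary16_maxRat_window`) and
  `W_binary16(n) = W_ψ(n)` for `n ≤ 1043` (`worstP_Binary16_eq_wide_window`).
No numerics; `decide`/`norm_num` only on format constants and alphabet membership.

References: [IEEE7542019, §4.3.1], [BoldoEtAl2023, Thm 4.5], [LangeRump2019], [Higham2002, §4.2].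
-/

namespace Summit.Ventures.CertifiedArithmetic.LowPrec.Gemm

open Literature.ComputerArithmetic.FloatingPoint
open Literature.ComputerArithmetic.FloatingPoint.MiniFloat
open Finset

/-! ### A-priori size of the accumulator through the window (every precision `p ≥ 10`) -/

section Regime

variable {φ : Format}
variable (hm : 9 ≤ φ.manBits) (hq : φ.qexp ≤ -2) (hR : (2 : ℚ) ^ (φ.manBits + 10) ≤ φ.maxRat)
include hm hq hR

/-- For every word over the alphabet and every `j ≤ j₀ + 2^manBits + 4` (`144 j₀ + 9 < T`):
`|ŝ_j| ≤ (3/2)·Σ_{i≤j} |x_i|` — exact prefix up to `j₀`, relative error at most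
`k/(T+k) ≤ ½` afterwards (`worstP_le_window`). [cell] -/
theorem abs_seqSum_le_window {x : ℕ → ℚ} (hx : ∀ j, x j ∈ piE2M1) {j0 : ℕ}
    (hj0 : 144 * j0 + 9 < 2 ^ (φ.manBits + 1)) {j : ℕ} (hj : j ≤ j0 + 2 ^ φ.manBits + 4) :
    |(seqSum φ x j).toRat| ≤ 3 / 2 * ∑ i ∈ range (j + 1), |x i| := by
  have hL0 : 0 ≤ ∑ i ∈ range (j + 1), |x i| := sum_nonneg fun i _ => abs_nonneg _
  have hS : |∑ i ∈ range (j + 1), x i| ≤ ∑ i ∈ range (j + 1), |x i| := abs_sum_le_sum_abs _ _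
  have hrel : relErr φ x j ≤ 1 / 2 := by
    rcases Nat.lt_or_ge j0 j with hlt | hle
    swap
    · unfold relErr
      rw [seqSum_exact_prefix (by omega) hq hR hx (by omega) j hle, sub_self, abs_zero, zero_div]
      norm_num
    · obtain ⟨d, rfl⟩ : ∃ d, j = j0 + 1 + d := ⟨j - j0 - 1, by omega⟩
      have hd : d + 1 ≤ 2 ^ φ.manBits + 4 := by omega
      refine le_trans ((worstP_specE φ).1 x hx _) (le_trans (worstP_le_window hm hq hR hj0 hd) ?_)
      have hdq : (d : ℚ) + 1 ≤ 2 ^ φ.manBits + 4 := by exact_mod_cast hd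
      have hT : (2 : ℚ) ^ (φ.manBits + 1) = 2 * 2 ^ φ.manBits := by ring
      have h512 : (2 : ℚ) ^ 9 ≤ 2 ^ φ.manBits := pow_le_pow_right₀ (by norm_num) hm
      rw [div_le_iff₀ (by positivity), hT]
      norm_num at h512
      linarith
  by_cases hL : ∑ i ∈ range (j + 1), |x i| = 0
  · have hz : ∀ i ≤ j, x i = 0 := by
      intro i hi
      have := (sum_eq_zero_iff_of_nonneg fun i _ => abs_nonneg (x i)).mp hL i
        (mem_range.mpr (by omega))
      exact abs_eq_zero.mp this
    rw [seqSum_toRat_eq_zero_of_zero j hz, abs_zero]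
    positivity
  · have hLpos : 0 < ∑ i ∈ range (j + 1), |x i| := lt_of_le_of_ne hL0 (Ne.symm hL)
    have hE : |(seqSum φ x j).toRat - ∑ i ∈ range (j + 1), x i|
        ≤ 1 / 2 * ∑ i ∈ range (j + 1), |x i| := by
      unfold relErr at hrel
      rwa [div_le_iff₀ hLpos] at hrel
    have := abs_sub_abs_le_abs_sub (seqSum φ x j).toRat (∑ i ∈ range (j + 1), x i)
    linarith

end Regime

/-! ### binary16 inside a widened format, one window further -/

section Wide

variable {ψ : Format} (hmb : ψ.manBits = Format.Binary16.manBits) (hb : ψ.bias = Format.Binary16.bias)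
  (he : Format.Binary16.emaxCode ≤ ψ.emaxCode) (hM : Format.Binary16.maxRat ≤ ψ.maxRat)
  (hq : ψ.qexp ≤ -2) (hR : (2 : ℚ) ^ (ψ.manBits + 10) ≤ ψ.maxRat)
include hmb hb he hM hq hR

omit hb he hM in
/-- IN RANGE: every word of at most `1043` letters of `Π(E2M1,E2M1)`, accumulated in the widened
format, keeps every argument of the rounding below `54·1042 + 36 < 65504 = maxRat(binary16)` in
magnitude. [cell] -/
theorem E2M1_args_lt_Binary16_maxRat_window {x : ℕ → ℚ} (hx : ∀ j, x j ∈ piE2M1) {j : ℕ}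
    (hj : j ≤ 1041) :
    |(seqSum ψ x j).toRat + x (j + 1)| < Format.Binary16.maxRat := by
  have hm10 : ψ.manBits = 10 := hmb
  have hE := abs_seqSum_le_window (by omega) hq hR hx (j0 := 14) (by rw [hm10]; norm_num)
    (j := j) (by rw [hm10]; norm_num; omega)
  have hL := sum_abs_le hx (j + 1)
  have hx1 := abs_letter_le _ (hx (j + 1))
  have hjq : ((j + 1 : ℕ) : ℚ) ≤ 1042 := by exact_mod_cast (by omega : j + 1 ≤ 1042)
  rw [Format.Binary16_maxRat.1]
  calc |(seqSum ψ x j).toRat + x (j + 1)|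
      ≤ |(seqSum ψ x j).toRat| + |x (j + 1)| := abs_add_le _ _
    _ ≤ 3 / 2 * (36 * ((j + 1 : ℕ) : ℚ)) + 36 := by linarith
    _ < 65504 := by linarith

/-- THE TRANSFER one window further: for every word over the alphabet and every `m ≤ 1042`
(`n ≤ 1043` letters) the `binary16` accumulation and the widened one return the same values. [cell] -/
theorem seqSum_Binary16_eq_wide_window {x : ℕ → ℚ} (hx : ∀ j, x j ∈ piE2M1) {m : ℕ}
    (hm : m ≤ 1042) :
    (seqSum Format.Binary16 x m).toRat = (seqSum ψ x m).toRat := by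
  have hx0 : |x 0| < Format.Binary16.maxRat := by
    rw [Format.Binary16_maxRat.1]
    exact lt_of_le_of_lt (abs_letter_le _ (hx 0)) (by norm_num)
  exact seqSum_toRat_eq_of_wider hmb hb he (by decide) hM hx0 m fun j hj =>
    E2M1_args_lt_Binary16_maxRat_window hmb hq hR hx (by omega)

/-- … so the worst cases agree: `W_binary16(n) = W_ψ(n)` for `n = m + 1 ≤ 1043`.
[cell, gemm.tex Prop. p:fpW] -/
theorem worstP_Binary16_eq_wide_window {m : ℕ} (hm : m ≤ 1042) :
    worstRelErrE2M1 Format.Binary16 m = worstRelErrE2M1 ψ m := by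
  unfold worstRelErrE2M1
  congr 1
  funext w
  unfold relErr
  rw [seqSum_Binary16_eq_wide_window hmb hb he hM hq hR (wordInput_mem w) hm]

end Wide

/-! ### Prop. p:fp16 through the window, in the kernel -/

/-- THE EXACT WORST CASE OF FP4 PRODUCTS ACCUMULATED IN binary16, `16 ≤ n ≤ 1043`:
`W_11(15 + k) = k/(2^11 + k)` for every `1 ≤ k ≤ 2^10 + 4` (index `m = 14 + k`), attained by
`8, ¼, 36^{×14}, ¼^{×(k-1)}`; false from `k = 2^10 + 5` on (`worstP_Binary16_law_fails`).
[cell, gemm.tex Prop. p:fpW] -/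
theorem worstP_Binary16_window {k : ℕ} (hk : 1 ≤ k) (hk' : k ≤ 1028) :
    worstRelErrE2M1 Format.Binary16 (14 + k) = (k : ℚ) / (2 ^ 11 + k) := by
  obtain ⟨ψ, hmb, hb, he, hM, hq, hR⟩ := exists_binary16Wide
  have hm10 : ψ.manBits = 10 := hmb
  rw [worstP_Binary16_eq_wide_window hmb hb he hM hq hR (by omega)]
  have h := worstP_window (φ := ψ) (by rw [hm10]; norm_num) hq hR (j0 := 14) (A := 32) (B := 1)
    (by norm_num [piE2M1]) (by norm_num [piE2M1]) (by rw [hm10]; norm_num)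
    (by rw [hm10]; norm_num) hk (by rw [hm10]; norm_num; omega)
  rw [h, hm10]

/-- Prop. p:fp16 in the paper's variable, through the window: `W_11(n) = (n - 15)/(2033 + n)` for
every `16 ≤ n ≤ 1043` (index `m = n - 1`). [cell, gemm.tex Prop. p:fpW] -/
theorem worstP_Binary16_law_window {n : ℕ} (hn : 16 ≤ n) (hn' : n ≤ 1043) :
    worstRelErrE2M1 Format.Binary16 (n - 1) = ((n : ℚ) - 15) / (2033 + n) := by
  obtain ⟨k, rfl⟩ : ∃ k, n = 15 + k := ⟨n - 15, by omega⟩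
  rw [show 15 + k - 1 = 14 + k by omega, worstP_Binary16_window (by omega) (by omega)]
  push_cast
  rw [div_eq_div_iff (by positivity) (by positivity)]
  ring

/-- The four new binary16 values: `W_11(1040) = 1025/3073`, `W_11(1041) = 513/1537`,
`W_11(1042) = 1027/3075`, `W_11(1043) = 257/769` (indices `n - 1`). [cell, gemm.tex Prop. p:fpW] -/
theorem worstP_Binary16_window_values :
    worstRelErrE2M1 Format.Binary16 1039 = 1025 / 3073 ∧
    worstRelErrE2M1 Format.Binary16 1040 = 513 / 1537 ∧
    worstRelErrE2M1 Format.Binary16 1041 = 1027 / 3075 ∧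
    worstRelErrE2M1 Format.Binary16 1042 = 257 / 769 := by
  refine ⟨?_, ?_, ?_, ?_⟩
  · rw [show (1039 : ℕ) = 14 + 1025 from rfl, worstP_Binary16_window (by norm_num) (by norm_num)]
    norm_num
  · rw [show (1040 : ℕ) = 14 + 1026 from rfl, worstP_Binary16_window (by norm_num) (by norm_num)]
    norm_num
  · rw [show (1041 : ℕ) = 14 + 1027 from rfl, worstP_Binary16_window (by norm_num) (by norm_num)]
    norm_num
  · rw [show (1042 : ℕ) = 14 + 1028 from rfl, worstP_Binary16_window (by norm_num) (by norm_num)]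
    norm_num

end Summit.Ventures.CertifiedArithmetic.LowPrec.Gemm
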